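import Literature.ComputerArithmetic.HallmanIpsen2023.ComputationalTree
import Literature.ComputerArithmetic.JeannerodRump2018.OptimalBound
import Literature.ComputerArithmetic.BoldoJeannerodMelquiondMuller2023.ExactAddition

/-!
# Summation on a computational tree in binary floating-point arithmetic
(Hallman–Ipsen 2023, Theorem 7 and Higham 1993, (3.6), for IEEE-style round-to-nearest)

Honest framing: written for the shared numerical engines serving client cells; rigour lives in the
verifiers; every published number belongs to a client cell's ledger, not to the engines group.

`ComputationalTree.lean` proves the deterministic bounds of [HallmanIpsen2023, §2] and
[Higham1993, §§2–3] in MODEL form: every addition returns `(x̂ + ŷ)(1 + δ)` with `|δ| ≤ u`.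
Both sources state that the model HOLDS for floating-point arithmetic ([HallmanIpsen2023, §1.2
"Individual roundoffs … in real floating point arithmetic … fl(x op y) = (x op y)(1+δ), |δ| ≤ u";
[Higham1993, eq. (1.2)]), and for round-to-nearest BINARY arithmetic the optimal constant is
`|δ| ≤ u/(1+u)` ([JeannerodRump2018, eq. (4.1)], proved in the tree as
`JeannerodRump2018.abs_err_add_le_sharp`, gradual underflow included, no overflow).
This file discharges the model hypotheses in that setting — precision `p ≥ 1`, floats
`JeannerodRump2018.IsFloat p emin`, ANY round-to-nearest map `JeannerodRump2018.IsRoundNearest p emin fl`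
(any tie rule), exact rational arithmetic — and restates the theorems for the floating-point
evaluation `evalFl fl t` of a summation tree whose leaves are floats:

* `reround fl t` — the tree carrying the ACTUAL relative rounding errors of the evaluation;
  `comp_reround : (reround fl t).comp = evalFl fl t`, `roundoff_reround : Roundoff (u/(1+u))`.
* `abs_evalFl_sub_exact_le` — [HallmanIpsen2023, Thm. 7 of the arXiv text] for floats:
  `|ŝ − s| ≤ λ_h h u' Σ|x_j|`, `u' = u/(1+u)`, `λ_h = (1+u')^h`, and the printed form with `u`.
* `abs_evalFl_sub_exact_le_pow` — [Higham1993, (2.6)/(3.6)] for floats: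
  `|ŝ − s| ≤ ((1+u')^h − 1) Σ|x_i| ≤ ((1+u)^h − 1) Σ|x_i|`.
* `pairwiseFl`, `abs_pairwiseFl_sub_sum_le` — PAIRWISE summation of `n ≥ 1` floats:
  `|ŝ − Σx_i| ≤ ((1+u)^{⌈log₂ n⌉} − 1) Σ|x_i|` ([Higham1993, (3.6)]: `γ_{log₂ n}` for `n = 2^r`);
  `recursiveFl`, `abs_recursiveFl_sub_sum_le` — recursive summation, `((1+u)^{n−1} − 1) Σ|x_i|`
  ([Higham1993, (2.6)]: `γ_{n−1}`).

Numbering caveat for [HallmanIpsen2023] as in `ComputationalTree.lean` (arXiv running numbers).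
-/

namespace Literature.ComputerArithmetic.HallmanIpsen2023

open Literature.ComputerArithmetic.JeannerodRump2018 (IsFloat IsRoundNearest unitRoundoff
  abs_err_add_le_sharp)
open Literature.ComputerArithmetic.BoldoJeannerodMelquiondMuller2023 (fl_zero)

namespace CompTree

/-- Floating-point evaluation of the summation represented by the SHAPE of a tree, with the
rounding map `fl` (one rounding per addition; the `δ` fields are ignored).
[cite: HallmanIpsen2023, §2, Algorithm "General summation" with §1.2 (`ŝ_k` = the sum computed in
floating point arithmetic)] -/
def evalFl (fl : ℚ → ℚ) : CompTree ℚ → ℚ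
  | leaf x => x
  | node _ l r => fl (evalFl fl l + evalFl fl r)

/-- The relative error `δ = (fl(t) − t)/t` of one rounding (`0` at `t = 0`).
[cite: HallmanIpsen2023, §1.2, eq. `fl(x op y) = (x op y)(1 + δ)`] -/
def relErr (fl : ℚ → ℚ) (t : ℚ) : ℚ := if t = 0 then 0 else (fl t - t) / t

/-- The same tree carrying the ACTUAL relative rounding errors committed by `evalFl fl`.
[cite: HallmanIpsen2023, §1.2 ("Individual roundoffs" `δ_k`) and §2 Definition "Computational
tree"] -/
def reround (fl : ℚ → ℚ) : CompTree ℚ → CompTree ℚ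
  | leaf x => leaf x
  | node _ l r => node (relErr fl (evalFl fl l + evalFl fl r)) (reround fl l) (reround fl r)

section Shape

variable (fl : ℚ → ℚ)

/-- `reround` keeps the exact sum. [cite: HallmanIpsen2023, §2, Definition "Computational tree"] -/
theorem exact_reround : ∀ t : CompTree ℚ, (reround fl t).exact = t.exact
  | leaf x => rfl
  | node _ l r => by simp [reround, exact, exact_reround l, exact_reround r]

/-- `reround` keeps the inputs. [cite: HallmanIpsen2023, §2, Definition "Computational tree"] -/
theorem inputs_reround : ∀ t : CompTree ℚ, (reround fl t).inputs = t.inputs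
  | leaf x => rfl
  | node _ l r => by simp [reround, inputs, inputs_reround l, inputs_reround r]

/-- `reround` keeps `Σ|x_j|`. [cite: HallmanIpsen2023, §2, Lemma "Relation between partial sums
and inputs"] -/
theorem absInputs_reround : ∀ t : CompTree ℚ, (reround fl t).absInputs = t.absInputs
  | leaf x => rfl
  | node _ l r => by simp [reround, absInputs, absInputs_reround l, absInputs_reround r]

/-- `reround` keeps the height. [cite: HallmanIpsen2023, §2, Definition "Computational tree"] -/
theorem height_reround : ∀ t : CompTree ℚ, (reround fl t).height = t.height
  | leaf x => rfl
  | node _ l r => by simp [reround, height, height_reround l, height_reround r]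

/-- `evalFl` only depends on the shape: it is unchanged by `reround`.
[cite: HallmanIpsen2023, §2, Algorithm "General summation"] -/
theorem evalFl_reround : ∀ t : CompTree ℚ, evalFl fl (reround fl t) = evalFl fl t
  | leaf x => rfl
  | node _ l r => by simp [reround, evalFl, evalFl_reround l, evalFl_reround r]

/-- With the actual roundoffs in place, the MODEL value `comp` IS the floating-point value:
`ŝ_k = (x̂ + ŷ)(1 + δ_k)` with `δ_k = (fl(x̂+ŷ) − (x̂+ŷ))/(x̂+ŷ)` (requires `fl 0 = 0`).
[cite: HallmanIpsen2023, §1.2, eq. `fl(x op y) = (x op y)(1+δ)`; §2.1, proof of Lemma "Second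
explicit expression" (`ŝ_k = (x̂ + ŷ)(1+δ_k)`)] -/
theorem comp_reround (h0 : fl 0 = 0) : ∀ t : CompTree ℚ, (reround fl t).comp = evalFl fl t
  | leaf x => rfl
  | node _ l r => by
      simp only [reround, comp, evalFl, comp_reround h0 l, comp_reround h0 r, relErr]
      split_ifs with h
      · rw [h, h0]; ring
      · field_simp
        ring

end Shape

section Float

variable {p : ℕ} {emin : ℤ} {fl : ℚ → ℚ}

/-- Every computed partial sum is a float (it is a value of `fl`).
[cite: HallmanIpsen2023, §1.2 (`ŝ_k` computed in floating point arithmetic)] -/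
theorem isFloat_evalFl (hfl : IsRoundNearest p emin fl) :
    ∀ t : CompTree ℚ, (∀ x ∈ t.inputs, IsFloat p emin x) → IsFloat p emin (evalFl fl t)
  | leaf x, h => by simpa [evalFl, inputs] using h
  | node _ l r, _ => (hfl _).1

/-- THE MODEL HOLDS: in binary precision-`p` round-to-nearest arithmetic (any tie rule, gradual
underflow, no overflow) every addition of the evaluation commits a relative error
`|δ_k| ≤ u/(1+u)` (`≤ u`), `u = 2^{-p}`.
[cite: HallmanIpsen2023, §1.2, eq. `fl(x op y) = (x op y)(1+δ)`, `|δ| ≤ u`; JeannerodRump2018,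
eq. (4.1) (the optimal constant `u/(1+u)` for addition)] -/
theorem roundoff_reround (hp : 1 ≤ p) (hfl : IsRoundNearest p emin fl) :
    ∀ t : CompTree ℚ, (∀ x ∈ t.inputs, IsFloat p emin x) →
      (reround fl t).Roundoff (unitRoundoff p / (1 + unitRoundoff p))
  | leaf x, _ => trivial
  | node _ l r, hx => by
      have hxl : ∀ x ∈ l.inputs, IsFloat p emin x := fun x hx' => hx x (by simp [inputs, hx'])
      have hxr : ∀ x ∈ r.inputs, IsFloat p emin x := fun x hx' => hx x (by simp [inputs, hx'])
      refine ⟨?_, roundoff_reround hp hfl l hxl, roundoff_reround hp hfl r hxr⟩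
      have ha := isFloat_evalFl hfl l hxl
      have hb := isFloat_evalFl hfl r hxr
      have hupos : 0 < unitRoundoff p := by unfold unitRoundoff; positivity
      simp only [relErr]
      split_ifs with h
      · rw [abs_zero]; exact div_nonneg hupos.le (by linarith)
      · have key := abs_err_add_le_sharp hp hfl ha hb
        rw [abs_div, div_le_iff₀ (abs_pos.mpr h)]
        exact key

/-- `Roundoff` is monotone in the bound. [cite: HallmanIpsen2023, §1.2 (`|δ| ≤ u`)] -/
theorem Roundoff.mono {K : Type*} [Field K] [LinearOrder K] [IsStrictOrderedRing K] {u v : K}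
    (huv : u ≤ v) : ∀ t : CompTree K, t.Roundoff u → t.Roundoff v
  | leaf _, _ => trivial
  | node _ l r, ⟨h, hl, hr⟩ => ⟨h.trans huv, Roundoff.mono huv l hl, Roundoff.mono huv r hr⟩

/-- `u/(1+u) ≤ u`. [cite: JeannerodRump2018, eq. (4.1) (`u/(1+u) < u`)] -/
theorem unitRoundoff_div_le (p : ℕ) :
    unitRoundoff p / (1 + unitRoundoff p) ≤ unitRoundoff p := by
  have hupos : 0 < unitRoundoff p := by unfold unitRoundoff; positivity
  rw [div_le_iff₀ (by linarith)]
  nlinarith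

/-- In the same arithmetic the roundoffs also satisfy the classical `|δ_k| ≤ u`.
[cite: HallmanIpsen2023, §1.2, eq. `fl(x op y) = (x op y)(1+δ)`, `|δ| ≤ u`; Higham1993, eq. (1.2)] -/
theorem roundoff_reround_u (hp : 1 ≤ p) (hfl : IsRoundNearest p emin fl) (t : CompTree ℚ)
    (hx : ∀ x ∈ t.inputs, IsFloat p emin x) : (reround fl t).Roundoff (unitRoundoff p) :=
  Roundoff.mono (unitRoundoff_div_le p) _ (roundoff_reround hp hfl t hx)

/-- HALLMAN–IPSEN THEOREM 7 IN FLOATING-POINT ARITHMETIC: for a summation tree of height `h` whose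
`n` leaves are floats, evaluated in ANY binary precision-`p` round-to-nearest arithmetic,
`|ŝ_n − s_n| ≤ λ_h u' Σ_{k=2}^{n}|s_k| ≤ λ_h h u' Σ_j |x_j|` with `u' = u/(1+u)`, `λ_h = (1+u')^h`
(hence also with `u` in place of `u'`).
[cite: HallmanIpsen2023, §2.1, Theorem "deterministic bound" (Thm. 7 of the arXiv text) with
§1.2; JeannerodRump2018, eq. (4.1)] -/
theorem abs_evalFl_sub_exact_le (hp : 1 ≤ p) (hfl : IsRoundNearest p emin fl) (t : CompTree ℚ)
    (hx : ∀ x ∈ t.inputs, IsFloat p emin x) :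
    let u' := unitRoundoff p / (1 + unitRoundoff p)
    |evalFl fl t - t.exact| ≤ (1 + u') ^ t.height * u' * (reround fl t).sumAbsPartial ∧
      |evalFl fl t - t.exact| ≤ (1 + u') ^ t.height * (t.height : ℚ) * u' * t.absInputs ∧
      |evalFl fl t - t.exact|
        ≤ (1 + unitRoundoff p) ^ t.height * (t.height : ℚ) * unitRoundoff p * t.absInputs := by
  intro u'
  have hupos : 0 < unitRoundoff p := by unfold unitRoundoff; positivity
  have hu' : 0 ≤ u' := div_nonneg hupos.le (by linarith)
  have hR := roundoff_reround hp hfl t hx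
  have hRu := roundoff_reround_u hp hfl t hx
  have h := abs_err_le hu' (reround fl t) hR
  have hu := abs_err_le hupos.le (reround fl t) hRu
  simp only [err, comp_reround fl (fl_zero hfl), exact_reround, height_reround,
    absInputs_reround] at h hu
  exact ⟨h.1, h.2, hu.2⟩

/-- HIGHAM'S BOUND IN FLOATING-POINT ARITHMETIC: for a summation tree of height `h` with float
leaves and any binary round-to-nearest arithmetic,
`|ŝ_n − s_n| ≤ ((1+u')^h − 1) Σ_i |x_i| ≤ ((1+u)^h − 1) Σ_i |x_i|` (`u' = u/(1+u)`;
`(1+u)^h − 1 ≤ γ_h`). [cite: Higham1993, p. 785 eq. (2.6) (recursive, `h = n−1`) and p. 788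
eq. (3.6) (pairwise, `h = log₂ n`), with eq. (1.2); JeannerodRump2018, eq. (4.1)] -/
theorem abs_evalFl_sub_exact_le_pow (hp : 1 ≤ p) (hfl : IsRoundNearest p emin fl)
    (t : CompTree ℚ) (hx : ∀ x ∈ t.inputs, IsFloat p emin x) :
    |evalFl fl t - t.exact|
        ≤ ((1 + unitRoundoff p / (1 + unitRoundoff p)) ^ t.height - 1) * t.absInputs ∧
      |evalFl fl t - t.exact| ≤ ((1 + unitRoundoff p) ^ t.height - 1) * t.absInputs := by
  have hupos : 0 < unitRoundoff p := by unfold unitRoundoff; positivity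
  have hu' : 0 ≤ unitRoundoff p / (1 + unitRoundoff p) := div_nonneg hupos.le (by linarith)
  have h := (abs_err_le_gamma hu' (reround fl t) (roundoff_reround hp hfl t hx)).1
  have hu := (abs_err_le_gamma hupos.le (reround fl t) (roundoff_reround_u hp hfl t hx)).1
  simp only [err, comp_reround fl (fl_zero hfl), exact_reround, height_reround,
    absInputs_reround] at h hu
  exact ⟨h, hu⟩

/-- PAIRWISE SUMMATION of the floats `x₁, …, x_n` in the arithmetic `fl`
(`⌈log₂ n⌉` stages of pairwise additions). [cite: Higham1993, p. 788 (pairwise summation)] -/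
def pairwiseFl (fl : ℚ → ℚ) (xs : List ℚ) : ℚ := evalFl fl (pairwiseTree (fun _ _ => 0) xs)

/-- RECURSIVE SUMMATION of the floats `x₀, x₁, …` in the arithmetic `fl`
(`ŝ₀ = x₀`, `ŝ_k = fl(ŝ_{k−1} + x_k)`). [cite: Higham1993, §2, eq. (2.1)] -/
def recursiveFl (fl : ℚ → ℚ) (x₀ : ℚ) (xs : List ℚ) : ℚ :=
  evalFl fl (recursiveTree (fun _ => 0) x₀ xs)

/-- PAIRWISE SUMMATION ERROR BOUND IN FLOATING-POINT ARITHMETIC: for `n ≥ 1` floats and any binary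
precision-`p` round-to-nearest arithmetic,
`|ŝ − Σ x_i| ≤ ((1+u)^{⌈log₂ n⌉} − 1) Σ|x_i|` (`≤ γ_{⌈log₂ n⌉} Σ|x_i|`).
[cite: Higham1993, p. 788, eq. (3.6) (`|E_n| ≤ γ_{log₂ n} Σ|x_i|`, `n = 2^r`), with eq. (1.2)] -/
theorem abs_pairwiseFl_sub_sum_le (hp : 1 ≤ p) (hfl : IsRoundNearest p emin fl) (xs : List ℚ)
    (hxs : xs ≠ []) (hx : ∀ x ∈ xs, IsFloat p emin x) :
    |pairwiseFl fl xs - xs.sum|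
      ≤ ((1 + unitRoundoff p) ^ Nat.clog 2 xs.length - 1) * (xs.map (|·|)).sum := by
  have hupos : 0 < unitRoundoff p := by unfold unitRoundoff; positivity
  set t := pairwiseTree (fun _ _ => (0 : ℚ)) xs with ht
  obtain ⟨hin, hh⟩ := pairwiseTree_inputs_height (fun _ _ => (0 : ℚ)) xs hxs
  have hx' : ∀ x ∈ t.inputs, IsFloat p emin x := by rw [hin]; exact hx
  have h := (abs_evalFl_sub_exact_le_pow hp hfl t hx').2
  rw [exact_eq_sum, absInputs_eq_sum, hin] at h
  refine h.trans (mul_le_mul_of_nonneg_right ?_ ?_)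
  · have h1u : (1 : ℚ) ≤ 1 + unitRoundoff p := by linarith
    linarith [pow_le_pow_right₀ h1u hh]
  · exact List.sum_nonneg (by
      intro a ha
      obtain ⟨b, _, rfl⟩ := List.mem_map.mp ha
      exact abs_nonneg b)

/-- RECURSIVE SUMMATION ERROR BOUND IN FLOATING-POINT ARITHMETIC: for floats `x₀, …, x_m`
(`n = m + 1` numbers) and any binary precision-`p` round-to-nearest arithmetic,
`|ŝ − Σ x_i| ≤ ((1+u)^{n−1} − 1) Σ|x_i|` (`≤ γ_{n−1} Σ|x_i|`).
[cite: Higham1993, p. 785, eq. (2.6) (`|E_n| ≤ γ_{n−1} Σ|x_i|`), with eq. (1.2)] -/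
theorem abs_recursiveFl_sub_sum_le (hp : 1 ≤ p) (hfl : IsRoundNearest p emin fl) (x₀ : ℚ)
    (xs : List ℚ) (hx : ∀ x ∈ x₀ :: xs, IsFloat p emin x) :
    |recursiveFl fl x₀ xs - (x₀ :: xs).sum|
      ≤ ((1 + unitRoundoff p) ^ xs.length - 1) * ((x₀ :: xs).map (|·|)).sum := by
  set t := recursiveTree (fun _ => (0 : ℚ)) x₀ xs with ht
  obtain ⟨hin, hh⟩ := recursiveTree_inputs_height (fun _ => (0 : ℚ)) x₀ xs
  have hx' : ∀ x ∈ t.inputs, IsFloat p emin x := by rw [hin]; exact hx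
  have h := (abs_evalFl_sub_exact_le_pow hp hfl t hx').2
  rw [exact_eq_sum, absInputs_eq_sum, hin, hh] at h
  exact h

end Float

end CompTree

end Literature.ComputerArithmetic.HallmanIpsen2023
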